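import Literature.MathematicalPhysics.QuantumFieldTheory.Balaban1983to89.B9CubeSequence408
import Literature.MathematicalPhysics.QuantumFieldTheory.Balaban1983to89.B6MultiLevelTorusMirrorMajorant

/-!
# `Balaban1983to89.B9CubeSequence408Mirrors` — [Balaban1985BackgroundPropagators] p. 408–409, p. 394: THE DIRICHLET DOMAIN `Ω₀(□)` OF A COVER CUBE AS AN EMBEDDED
# MIRROR BOX of the nested cube family `{Ω_n(□)}` (r05's `B9CubeSequence408.cubeFam`) — the mirror datum `(k′, mir, m, g)` of □, its FIT and MARGIN binders
# discharged, and `C₁(□) ⊂ Ω₀(□)` (ROAD (I) «IMAGES», file D3c-α)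

FRAMING (verbatim cell line):
statement-level skeleton of published theorems with citation tags; proofs where landed; nothing here is a claim about the Yang–Mills mass gap

Sources: T. Bałaban, *Propagators for lattice gauge theories in a background field*, Commun. Math. Phys. **99** (1985) 389–434
[`Balaban1985BackgroundPropagators`], p. 394 («Δ′_a(U) … restricted to Ω₀ with Dirichlet boundary conditions … Ω₀Δ′_aΩ₀»), p. 408 («Ω_n(□) is a cube with a center
at the center of □ … dist(Ω₀(□)ᶜ, □⁴) < 2R₀M₀L^jη, hence Ω₀(□) ⊂ □⁵»), p. 409 l. 1–5; T. Bałaban, *Propagators and renormalization transformations for lattice gauge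
theories. II*, Commun. Math. Phys. **96** (1984) 223–250 [`Balaban1984PropagatorsII`], (2.1)–(2.4) p. 224; T. Bałaban, *Regularity and decay of lattice Green's
functions*, Commun. Math. Phys. **89** (1983) 571–597 [`Balaban1983RegularityDecay`], (2.42) p. 584.  Unit `pub-ymgap-dag-n06-c` (g31); custodian word node00-def-Y g38
I.12252 (Q2: the Dirichlet exterior is a binder `S`, the mirror box is an acceptable `Ω₀(□)`).

## WHAT THIS FILE CERTIFIES (kernel-checked; `η = 1`, `L = ℓ + 1`, `S_n = bigSide L M_h n = M_h L^{n+1}`)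

For a global family `D` and a cover cube `q = (j, β)` with cube family `F = cubeFam D q` (levels `≤ min(j+1, k) =: k′ = kTop q`, top side `s = S_{k′}`):
* THE MIRROR DATUM OF □: in the direction `μ` the cube is MIRRORED (`mirC q μ`) iff the window of `C₁(□)` plus five top blocks fits in the torus,
  `2w₁ + 1 + 5s ≤ N₀_μ` (`w₁ = wid L M_h R j 1` the half-width of `C₁(□)`); then `m = ⌊(2w₁+1)/s⌋ + 4` half-period blocks (`mC`) and the shift `g_μ = s⌊(c_μ − w₁ − h − s)/s⌋`
  (`gC`; `c = ctrC q` the centre of `β`, `h = hMir = (s−1)/2`), so that the embedded open box `(h, h + ms) + g_μ` contains the window `[c_μ − w₁, c_μ + w₁]` with a margin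
  of one top block on either side (`window_sub_box`); otherwise (small torus) the direction wraps (`g_μ = 0`, the full circle);
* the standing binders of D2b–D3d′ DISCHARGED for this datum: `kTop_le`, `one_le_kTop`, `lev_cubeFam_le_kTop`, `two_le_mC`, `sTop_dvd_gC`, ★ `fitC` (FIT:
  `n_μ + s ≤ N₀_μ`), ★★ `margC` (MARGIN: every block of the reflected cube family meeting the open box lies in it — positive levels live in `C₁(□)`
  (`lev_cubeFam_eq_zero`), whose window sits one top block inside the box (`coord_window_of_InC`), and a block is narrower than a top block);
* `dirDomC D q …` — **THE DIRICHLET DOMAIN `Ω₀(□)`** = the image of the open mirror box under `emb g` (a `Finset` of sites of the member's torus), with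
  ★ `mem_dirDomC_of_InC` (`C₁(□) ⊂ Ω₀(□)`, hence every site of positive cube level: `mem_dirDomC_of_lev_pos`), `embC` ∕ `embC_bijective` ∕ `embEquivC`
  (the open box is in bijection with `Ω₀(□)`, by D3b `emb_injOn_closed`).

## HONEST SCOPE

Print's `Ω₀(□)` is «a cube with center at the center of □» at distance `2R₀M₀η` outside `Ω₁(□)`, inside `□⁵`; here `Ω₀(□)` is the product of the windows
`(h, h + m s) + g_μ` (between consecutive top-block CENTRES, where the method of images needs its mirrors) in the mirrored directions and of the full circles in the
others, containing `C₁(□) ⊇ Ω₁(□)` with a collar of at least one top block and at most about three — a harmless enlargement (O(L) top blocks instead of print's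
`O(1)`; the constants of Thms 3.1–3.3 are functions of `d, L`), declared.  A direction WRAPS exactly when the torus is too small for the window plus five top blocks
(then print's cube is the whole torus in that direction as well, up to the same O(L)).  No estimate here: the Dirichlet letter and its (3.42)₁ are file D3c-β.
Nothing continuum ∕ OS ∕ Clay; N06 is not discharged by this file; the YM mass gap is not proved by any of this.
-/

namespace Literature.MathematicalPhysics.QuantumFieldTheory.Balaban1983to89.B9CubeSequence408Mirrors

noncomputable section

open Finset Matrix
open Literature.MathematicalPhysics.QuantumFieldTheory.Balaban1983to89.B4Reflection242 (boxDom mem_boxDom blk)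
open Literature.MathematicalPhysics.QuantumFieldTheory.Balaban1983to89.B4TorusKernel.MultiPeriod (torusSupNorm circAbs centre abs_add_mul_centre circAbs_nonneg)
open Literature.MathematicalPhysics.QuantumFieldTheory.Balaban1983to89.B6MultiLevelBoxOperator (N0 bigSide one_le_bigSide)
open Literature.MathematicalPhysics.QuantumFieldTheory.Balaban1983to89.B6MultiLevelTorusOperator (twrap tshift mlOpT gmlT one_le_of_mem one_le_N0 N0_eq_bigSide_mul)
open Literature.MathematicalPhysics.QuantumFieldTheory.Balaban1983to89.B6MultiLevelTorusOperatorL0 (TDomains)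
open Literature.MathematicalPhysics.QuantumFieldTheory.Balaban1983to89.B6Cover236MultiLevelBlocks (cubes)
open Literature.MathematicalPhysics.QuantumFieldTheory.Balaban1983to89.B9CubeSequence408 (sI hf wid collar ctrC InC cubeFam lev_cubeFam_eq_zero sI_pos
  cube_level_le one_le_cube_level collar_nonneg lev_cubeFam_le_succ)
open Literature.MathematicalPhysics.QuantumFieldTheory.Balaban1983to89.B4Eq242TorusMirrors
open Literature.MathematicalPhysics.QuantumFieldTheory.Balaban1983to89.B6MultiLevelTorusMirrorL0
open Literature.MathematicalPhysics.QuantumFieldTheory.Balaban1983to89.B6MultiLevelTorusMirrorCompression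
open Literature.MathematicalPhysics.QuantumFieldTheory.Balaban1983to89.B6MultiLevelTorusMirrorDecay (pow_dvd_sTop)

variable {d : ℕ}

/-! ## §1  The mirror datum of a cover cube -/

section Datum

variable {ℓ Mh k R : ℕ} {P : Fin (d + 1) → ℕ} {D : B6MultiLevelTorusOperator.TDomains d ℓ Mh k P R}

/-- the TOP LEVEL `k′ = min(j + 1, k)` of the cube family of `□ = (j, β)`. [cite: Balaban1985BackgroundPropagators, p.408 («{Ω_n(□)}_{n=0,…,j+1}»), dictionary] -/
def kTop (q : ↥(cubes D.toDomains)) : ℕ := min (q.1.1 + 1) k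

/-- `k′ ≤ k`. [cite: Balaban1985BackgroundPropagators, p.408, bookkeeping] -/
theorem kTop_le (q : ↥(cubes D.toDomains)) : kTop q ≤ k := min_le_right _ _

/-- `1 ≤ k′`. [cite: Balaban1985BackgroundPropagators, p.408, bookkeeping] -/
theorem one_le_kTop (q : ↥(cubes D.toDomains)) : 1 ≤ kTop q :=
  le_min (Nat.succ_le_succ (Nat.zero_le _)) ((one_le_cube_level q).trans (cube_level_le q))

/-- the cube family's levels are at most `k′`. [cite: Balaban1985BackgroundPropagators, p.408, bookkeeping] -/
theorem lev_cubeFam_le_kTop {hL : Odd (ℓ + 1)} {hM : Odd Mh} {hMh : 1 ≤ Mh} {hP : ∀ μ, 1 ≤ P μ} (q : ↥(cubes D.toDomains)) :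
    ∀ x, (cubeFam D q hL hM hMh hP).lev x ≤ kTop q :=
  fun x => le_min (lev_cubeFam_le_succ x) ((cubeFam D q hL hM hMh hP).lev_le x)

/-- the half-width `w₁` of `C₁(□)` is non-negative. [cite: Balaban1985BackgroundPropagators, p.408, bookkeeping] -/
theorem wid_nonneg (hMh : 1 ≤ Mh) (j J : ℕ) : 0 ≤ wid ℓ Mh R j J := by
  unfold wid hf
  have := sI_pos (ℓ := ℓ) hMh j
  have := collar_nonneg (ℓ := ℓ) hMh R j J
  omega

/-- **THE MIRRORED DIRECTIONS OF □**: `μ` is mirrored iff the window of `C₁(□)` plus five top blocks fits in the torus, `2w₁ + 1 + 5S_{k′} ≤ N₀_μ` (otherwise the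
direction wraps). [cite: Balaban1985BackgroundPropagators, p.408 («Ω₀(□) ⊂ □⁵»), dictionary] -/
def mirC (q : ↥(cubes D.toDomains)) : Fin (d + 1) → Bool := fun μ =>
  decide (2 * wid ℓ Mh R q.1.1 1 + 1 + 5 * sTop ℓ Mh (kTop q) ≤ (N0 ℓ Mh k P μ : ℤ))

/-- the number `m = ⌊(2w₁ + 1)/S_{k′}⌋ + 4` of top blocks in a half-period of the doubled torus. [cite: Balaban1983RegularityDecay, (2.42) p.584, dictionary] -/
def mC (q : ↥(cubes D.toDomains)) : Fin (d + 1) → ℕ := fun _ =>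
  ((2 * wid ℓ Mh R q.1.1 1 + 1) / sTop ℓ Mh (kTop q)).toNat + 4

/-- the SHIFT `g_μ = S_{k′}·⌊(c_μ − w₁ − h − S_{k′})/S_{k′}⌋` embedding the mirror box one top block below the window of `C₁(□)` (`0` in a wrapping direction).
[cite: Balaban1983RegularityDecay, (2.42) p.584; Balaban1985BackgroundPropagators, p.408, dictionary] -/
def gC (q : ↥(cubes D.toDomains)) : Fin (d + 1) → ℤ := fun μ =>
  if mirC q μ = true then sTop ℓ Mh (kTop q) * ((ctrC q μ - wid ℓ Mh R q.1.1 1 - hMir ℓ Mh (kTop q) - sTop ℓ Mh (kTop q)) / sTop ℓ Mh (kTop q)) else 0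

/-- the fit test, unfolded. [cite: Balaban1985BackgroundPropagators, p.408, bookkeeping] -/
theorem fit_of_mirC {q : ↥(cubes D.toDomains)} {μ : Fin (d + 1)} (hμ : mirC q μ = true) :
    2 * wid ℓ Mh R q.1.1 1 + 1 + 5 * sTop ℓ Mh (kTop q) ≤ (N0 ℓ Mh k P μ : ℤ) := by
  unfold mirC at hμ; exact of_decide_eq_true hμ

/-- `m ≥ 2` (indeed `≥ 4`). [cite: Balaban1983RegularityDecay, (2.42) p.584, bookkeeping] -/
theorem two_le_mC (q : ↥(cubes D.toDomains)) : ∀ μ, mirC q μ = true → 2 ≤ mC q μ := by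
  intro μ _; unfold mC; omega

/-- `S_{k′} ∣ g_μ`. [cite: Balaban1984PropagatorsII, (2.1) p.224, bookkeeping] -/
theorem sTop_dvd_gC (q : ↥(cubes D.toDomains)) : ∀ μ, sTop ℓ Mh (kTop q) ∣ gC q μ := by
  intro μ; unfold gC
  split_ifs
  · exact Dvd.intro _ rfl
  · exact dvd_zero _

/-- the half-period `n_μ = m·S_{k′}`, unfolded. [cite: Balaban1983RegularityDecay, (2.42) p.584, bookkeeping] -/
theorem nMir_mC (hMh : 1 ≤ Mh) (q : ↥(cubes D.toDomains)) (μ : Fin (d + 1)) :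
    nMir ℓ Mh (kTop q) (mC q) μ = ((2 * wid ℓ Mh R q.1.1 1 + 1) / sTop ℓ Mh (kTop q)) * sTop ℓ Mh (kTop q) + 4 * sTop ℓ Mh (kTop q) := by
  unfold nMir mC
  have hw := wid_nonneg (ℓ := ℓ) (R := R) hMh q.1.1 1
  have hs := one_le_sTop (ℓ := ℓ) (k' := kTop q) hMh
  have h0 : 0 ≤ (2 * wid ℓ Mh R q.1.1 1 + 1) / sTop ℓ Mh (kTop q) := Int.ediv_nonneg (by omega) (by omega)
  push_cast
  rw [Int.toNat_of_nonneg h0]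
  ring

/-- ★ **FIT**: `n_μ + S_{k′} ≤ N₀_μ` in every mirrored direction. [cite: Balaban1984PropagatorsII, (2.1) p.224 (the torus), bookkeeping] -/
theorem fitC (hMh : 1 ≤ Mh) (q : ↥(cubes D.toDomains)) :
    ∀ μ, mirC q μ = true → nMir ℓ Mh (kTop q) (mC q) μ + sTop ℓ Mh (kTop q) ≤ (N0 ℓ Mh k P μ : ℤ) := by
  intro μ hμ
  have hfit := fit_of_mirC hμ
  rw [nMir_mC hMh]
  have hs := one_le_sTop (ℓ := ℓ) (k' := kTop q) hMh
  have h1 := Int.ediv_mul_le (2 * wid ℓ Mh R q.1.1 1 + 1) (show sTop ℓ Mh (kTop q) ≠ 0 by omega)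
  linarith

/-- the half-period dominates the window plus three top blocks: `n_μ ≥ 2w₁ + 2 + 3S_{k′}`. [cite: Balaban1985BackgroundPropagators, p.408, bookkeeping] -/
theorem window_le_nMir (hMh : 1 ≤ Mh) (q : ↥(cubes D.toDomains)) (μ : Fin (d + 1)) :
    2 * wid ℓ Mh R q.1.1 1 + 2 + 3 * sTop ℓ Mh (kTop q) ≤ nMir ℓ Mh (kTop q) (mC q) μ := by
  rw [nMir_mC hMh]
  have hs := one_le_sTop (ℓ := ℓ) (k' := kTop q) hMh
  set a := 2 * wid ℓ Mh R q.1.1 1 + 1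
  set s := sTop ℓ Mh (kTop q)
  have h1 : a / s * s = a - a % s := by rw [Int.emod_def]; ring
  have h2 : a % s < s := Int.emod_lt_of_pos a (by omega)
  rw [h1]; omega

/-- the embedded lower mirror `G_μ = h + g_μ` sits at least one top block below the window: `G_μ + S_{k′} ≤ c_μ − w₁`, and less than two below: `c_μ − w₁ < G_μ + 2S_{k′}`.
[cite: Balaban1985BackgroundPropagators, p.408; Balaban1983RegularityDecay, (2.42) p.584, bookkeeping] -/
theorem gC_window (hMh : 1 ≤ Mh) {q : ↥(cubes D.toDomains)} {μ : Fin (d + 1)} (hμ : mirC q μ = true) :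
    hMir ℓ Mh (kTop q) + gC q μ + sTop ℓ Mh (kTop q) ≤ ctrC q μ - wid ℓ Mh R q.1.1 1 ∧
      ctrC q μ - wid ℓ Mh R q.1.1 1 < hMir ℓ Mh (kTop q) + gC q μ + 2 * sTop ℓ Mh (kTop q) := by
  unfold gC; rw [if_pos hμ]
  have hs := one_le_sTop (ℓ := ℓ) (k' := kTop q) hMh
  set a := ctrC q μ - wid ℓ Mh R q.1.1 1 - hMir ℓ Mh (kTop q) - sTop ℓ Mh (kTop q) with ha
  set s := sTop ℓ Mh (kTop q)
  have h1 : s * (a / s) = a - a % s := by rw [Int.emod_def]; ring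
  have h2 : a % s < s := Int.emod_lt_of_pos a (by omega)
  have h3 : 0 ≤ a % s := Int.emod_nonneg a (by omega)
  rw [h1]; constructor <;> omega

/-- ★ **THE WINDOW OF `C₁(□)` SITS ONE TOP BLOCK INSIDE THE EMBEDDED BOX**: in a mirrored direction, if a torus coordinate `t` is within `w₁` of the centre and is the
image `(s′ + g_μ) mod N₀_μ` of an open-box coordinate `s′ ∈ [h + 1, h + n − 1]`, then `h + S_{k′} ≤ s′ ≤ h + n − S_{k′}`.
[cite: Balaban1985BackgroundPropagators, p.408 («dist(Ω₀(□)ᶜ, □⁴) …»); Balaban1983RegularityDecay, (2.42) p.584] -/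
theorem window_sub_box (hMh : 1 ≤ Mh) (hP : ∀ μ, 1 ≤ P μ) {q : ↥(cubes D.toDomains)} {μ : Fin (d + 1)}
    (hμ : mirC q μ = true) {t s' : ℤ} (ht : circAbs (N0 ℓ Mh k P μ) (t - ctrC q μ) ≤ wid ℓ Mh R q.1.1 1)
    (hs'lo : hMir ℓ Mh (kTop q) + 1 ≤ s') (hs'hi : s' ≤ hMir ℓ Mh (kTop q) + nMir ℓ Mh (kTop q) (mC q) μ - 1)
    (he : (s' + gC q μ) % (N0 ℓ Mh k P μ : ℤ) = t % (N0 ℓ Mh k P μ : ℤ)) :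
    hMir ℓ Mh (kTop q) + sTop ℓ Mh (kTop q) ≤ s' ∧ s' ≤ hMir ℓ Mh (kTop q) + nMir ℓ Mh (kTop q) (mC q) μ - sTop ℓ Mh (kTop q) := by
  have hN := one_le_N0 (ℓ := ℓ) (k := k) hMh hP μ
  have hN0 : (0 : ℤ) < N0 ℓ Mh k P μ := by exact_mod_cast hN
  obtain ⟨hG1, hG2⟩ := gC_window (ℓ := ℓ) (R := R) hMh hμ
  have hn := window_le_nMir (ℓ := ℓ) (R := R) hMh q μ
  have hfit := fitC (ℓ := ℓ) (R := R) hMh q μ hμ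
  have hs := one_le_sTop (ℓ := ℓ) (k' := kTop q) hMh
  -- the centred representative `t′ = t + N₀ r` of `t` lies in the window
  set r := centre (N0 ℓ Mh k P μ) (t - ctrC q μ) with hr
  have habs : |t - ctrC q μ + (N0 ℓ Mh k P μ : ℤ) * r| ≤ wid ℓ Mh R q.1.1 1 := by rw [abs_add_mul_centre hN]; exact ht
  obtain ⟨hlo, hhi⟩ := abs_le.1 habs
  -- both `s′ + g` and `t′` lie in `[G + 1, G + n − 1]`, a window shorter than `N₀`, and are congruent
  have hdvd : (N0 ℓ Mh k P μ : ℤ) ∣ (s' + gC q μ) - (t + (N0 ℓ Mh k P μ : ℤ) * r) := by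
    have h1 : (N0 ℓ Mh k P μ : ℤ) ∣ (s' + gC q μ) - t := Int.ModEq.dvd he.symm
    have h2 : (N0 ℓ Mh k P μ : ℤ) ∣ (N0 ℓ Mh k P μ : ℤ) * r := Dvd.intro _ rfl
    have := h1.sub h2
    rwa [show s' + gC q μ - t - (N0 ℓ Mh k P μ : ℤ) * r = s' + gC q μ - (t + (N0 ℓ Mh k P μ : ℤ) * r) by ring] at this
  have hbound : |(s' + gC q μ) - (t + (N0 ℓ Mh k P μ : ℤ) * r)| < (N0 ℓ Mh k P μ : ℤ) := by
    rw [abs_lt]; constructor <;> linarith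
  have h0 := Int.eq_zero_of_abs_lt_dvd hdvd hbound
  constructor <;> linarith

/-- conversely every torus coordinate within `w₁` of the centre IS such an image, of the coordinate `s′ = t + N₀r − g_μ` (`r` the centring integer), which lies in
`[h + S_{k′}, h + n − S_{k′}]`. [cite: Balaban1985BackgroundPropagators, p.408; Balaban1983RegularityDecay, (2.42) p.584] -/
theorem exists_preimage_coord (hMh : 1 ≤ Mh) (hP : ∀ μ, 1 ≤ P μ) {q : ↥(cubes D.toDomains)} {μ : Fin (d + 1)}
    (hμ : mirC q μ = true) {t : ℤ} (ht : circAbs (N0 ℓ Mh k P μ) (t - ctrC q μ) ≤ wid ℓ Mh R q.1.1 1) :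
    hMir ℓ Mh (kTop q) + sTop ℓ Mh (kTop q) ≤ t + (N0 ℓ Mh k P μ : ℤ) * centre (N0 ℓ Mh k P μ) (t - ctrC q μ) - gC q μ ∧
      t + (N0 ℓ Mh k P μ : ℤ) * centre (N0 ℓ Mh k P μ) (t - ctrC q μ) - gC q μ ≤ hMir ℓ Mh (kTop q) + nMir ℓ Mh (kTop q) (mC q) μ - sTop ℓ Mh (kTop q) ∧
      (t + (N0 ℓ Mh k P μ : ℤ) * centre (N0 ℓ Mh k P μ) (t - ctrC q μ) - gC q μ + gC q μ) % (N0 ℓ Mh k P μ : ℤ) = t % (N0 ℓ Mh k P μ : ℤ) := by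
  have hN := one_le_N0 (ℓ := ℓ) (k := k) hMh hP μ
  obtain ⟨hG1, hG2⟩ := gC_window (ℓ := ℓ) (R := R) hMh hμ
  have hn := window_le_nMir (ℓ := ℓ) (R := R) hMh q μ
  have habs : |t - ctrC q μ + (N0 ℓ Mh k P μ : ℤ) * centre (N0 ℓ Mh k P μ) (t - ctrC q μ)| ≤ wid ℓ Mh R q.1.1 1 := by
    rw [abs_add_mul_centre hN]; exact ht
  obtain ⟨hlo, hhi⟩ := abs_le.1 habs
  refine ⟨by linarith, by linarith, ?_⟩
  rw [sub_add_cancel, Int.add_mul_emod_self_left]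

end Datum

/-! ## §2  The standing binders of the reflected cube family: MARGIN -/

section Margin

variable {ℓ Mh k R : ℕ} {P : Fin (d + 1) → ℕ} {D : B6MultiLevelTorusOperator.TDomains d ℓ Mh k P R}
  {hL : Odd (ℓ + 1)} {hM : Odd Mh} {hMh : 1 ≤ Mh} {hP : ∀ μ, 1 ≤ P μ}

/-- **THE REFLECTED CUBE FAMILY** of □ on the doubled torus (D2b `reflected` at the mirror datum of □). [cite: Balaban1983RegularityDecay, (2.42) p.584; Balaban1985BackgroundPropagators, p.408] -/
abbrev reflC (D : B6MultiLevelTorusOperator.TDomains d ℓ Mh k P R) (q : ↥(cubes D.toDomains))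
    (hL : Odd (ℓ + 1)) (hM : Odd Mh) (hMh : 1 ≤ Mh) (hP : ∀ μ, 1 ≤ P μ) :
    TDomains d ℓ Mh (kTop q) (Pref ℓ k (kTop q) P (mirC q) (mC q)) R :=
  reflected (cubeFam D q hL hM hMh hP) (kTop q) (mirC q) (mC q) (gC q) hL hM hMh hP (kTop_le q) (lev_cubeFam_le_kTop q) (two_le_mC q) (sTop_dvd_gC q)

/-- **THE OPEN MIRROR BOX OF □** (unknowns of the Dirichlet problem, in the coordinates of the doubled torus). [cite: Balaban1985BackgroundPropagators, p.394 («Ω₀»); Balaban1983RegularityDecay, (2.42) p.584] -/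
abbrev boxC (D : B6MultiLevelTorusOperator.TDomains d ℓ Mh k P R) (q : ↥(cubes D.toDomains)) :
    Finset ↥(boxDom (N0 ℓ Mh (kTop q) (Pref ℓ k (kTop q) P (mirC q) (mC q)))) :=
  mirBoxOpen (N0 ℓ Mh (kTop q) (Pref ℓ k (kTop q) P (mirC q) (mC q))) (mirC q) (nMir ℓ Mh (kTop q) (mC q)) (fun _ => hMir ℓ Mh (kTop q))

/-- a site of the open box whose image lies in `C₁(□)` has its mirrored coordinates one top block inside the box.
[cite: Balaban1985BackgroundPropagators, p.408; Balaban1983RegularityDecay, (2.42) p.584] -/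
theorem coord_window_of_InC (hMh : 1 ≤ Mh) (hP : ∀ μ, 1 ≤ P μ) (q : ↥(cubes D.toDomains)) {x : ↥(boxDom (N0 ℓ Mh (kTop q) (Pref ℓ k (kTop q) P (mirC q) (mC q))))}
    (hx : x ∈ boxC D q) (hC : InC q 1 (B6MultiLevelTorusMirrorL0.emb (ℓ := ℓ) (Mh := Mh) (k := k) (P := P) (gC q) x.1))
    {μ : Fin (d + 1)} (hμ : mirC q μ = true) :
    hMir ℓ Mh (kTop q) + sTop ℓ Mh (kTop q) ≤ x.1 μ ∧ x.1 μ ≤ hMir ℓ Mh (kTop q) + nMir ℓ Mh (kTop q) (mC q) μ - sTop ℓ Mh (kTop q) := by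
  have hx' := hx
  simp only [boxC, mirBoxOpen, Finset.mem_filter, Finset.mem_univ, true_and] at hx'
  obtain ⟨h1, h2⟩ := hx' μ hμ
  refine window_sub_box hMh hP hμ (hC μ) (by omega) (by omega) ?_
  show (x.1 μ + gC q μ) % (N0 ℓ Mh k P μ : ℤ) = (twrap (N0 ℓ Mh k P) (x.1 + gC q)) μ % (N0 ℓ Mh k P μ : ℤ)
  unfold twrap
  rw [Pi.add_apply, Int.emod_emod_of_dvd _ (dvd_refl _)]

/-- two sites of one `L^J`-block differ by less than `L^J` in every coordinate. [cite: Balaban1984PropagatorsII, (2.1) p.224, bookkeeping] -/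
theorem abs_sub_lt_of_blk_eq {S : ℕ} (hS : 0 < S) {z x : Fin (d + 1) → ℤ} (h : blk S z = blk S x) (μ : Fin (d + 1)) :
    |z μ - x μ| < (S : ℤ) := by
  have hμ : z μ / (S : ℤ) = x μ / (S : ℤ) := congrFun h μ
  have hS' : (0 : ℤ) < S := by exact_mod_cast hS
  have hz := Int.emod_def (z μ) (S : ℤ)
  have hx := Int.emod_def (x μ) (S : ℤ)
  have h1 := Int.emod_nonneg (z μ) hS'.ne'
  have h2 := Int.emod_lt_of_pos (z μ) hS'
  have h3 := Int.emod_nonneg (x μ) hS'.ne'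
  have h4 := Int.emod_lt_of_pos (x μ) hS'
  rw [abs_lt]; rw [hμ] at hz; constructor <;> nlinarith

/-- ★★ **MARGIN**: every block of the reflected cube family containing a site of the open box lies in the open box.
[cite: Balaban1985BackgroundPropagators, p.408 («dist(Ω_n(□)ᶜ, Ω_{n+1}(□)) = 2R₀M₀Lⁿη»); Balaban1984PropagatorsII, (2.1) p.224; Balaban1983RegularityDecay, (2.42) p.584] -/
theorem margC (q : ↥(cubes D.toDomains)) :
    ∀ x : ↥(boxDom (N0 ℓ Mh (kTop q) (Pref ℓ k (kTop q) P (mirC q) (mC q)))), x ∈ boxC D q →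
      ∀ z : ↥(boxDom (N0 ℓ Mh (kTop q) (Pref ℓ k (kTop q) P (mirC q) (mC q)))),
        blk ((ℓ + 1) ^ (reflC D q hL hM hMh hP).lev x.1) z.1 = blk ((ℓ + 1) ^ (reflC D q hL hM hMh hP).lev x.1) x.1 → z ∈ boxC D q := by
  intro x hx z hb
  have hxc : x ∈ mirBoxClosed (N0 ℓ Mh (kTop q) (Pref ℓ k (kTop q) P (mirC q) (mC q))) (mirC q) (nMir ℓ Mh (kTop q) (mC q)) (fun _ => hMir ℓ Mh (kTop q)) :=
    mirBoxOpen_subset_closed hx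
  have hlev : (reflC D q hL hM hMh hP).lev x.1 = (cubeFam D q hL hM hMh hP).lev (B6MultiLevelTorusMirrorL0.emb (ℓ := ℓ) (Mh := Mh) (k := k) (P := P) (gC q) x.1) := by
    show (reflected _ _ _ _ _ _ _ _ _ _ _ _ _).lev x.1 = _
    rw [reflected_lev]; exact levR_of_mem_closed hxc
  set J := (reflC D q hL hM hMh hP).lev x.1 with hJ
  have hdiff := abs_sub_lt_of_blk_eq (Nat.pow_pos (Nat.succ_pos ℓ)) hb
  have hx2 := hx
  simp only [boxC, mirBoxOpen, Finset.mem_filter, Finset.mem_univ, true_and] at hx2 ⊢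
  intro μ hμ
  obtain ⟨h1, h2⟩ := hx2 μ hμ
  have hd := hdiff μ
  rcases Nat.eq_zero_or_pos J with h0 | hpos
  · -- level `0`: the block is the site itself
    rw [h0, pow_zero] at hd
    have : z.1 μ = x.1 μ := by rw [abs_lt] at hd; push_cast at hd; omega
    rw [this]; exact ⟨h1, h2⟩
  · -- positive level: the image lies in `C₁(□)`, one top block inside the box, and the block is narrower than a top block
    have hC : InC q 1 (B6MultiLevelTorusMirrorL0.emb (ℓ := ℓ) (Mh := Mh) (k := k) (P := P) (gC q) x.1) := by
      by_contra hnot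
      have := lev_cubeFam_eq_zero (D := D) (q := q) (hL := hL) (hM := hM) (hMh := hMh) (hP := hP) hnot
      rw [← hlev] at this; omega
    obtain ⟨hw1, hw2⟩ := coord_window_of_InC hMh hP q hx hC hμ
    have hJle : J ≤ kTop q + 1 := by rw [hlev]; exact (lev_cubeFam_le_kTop q _).trans (Nat.le_succ _)
    have hpow : (((ℓ + 1) ^ J : ℕ) : ℤ) ≤ sTop ℓ Mh (kTop q) :=
      Int.le_of_dvd (by have := one_le_sTop (ℓ := ℓ) (k' := kTop q) hMh; omega) (pow_dvd_sTop hJle)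
    rw [abs_lt] at hd
    constructor <;> linarith

end Margin

/-! ## §3  The Dirichlet domain `Ω₀(□)` and `C₁(□) ⊂ Ω₀(□)` -/

section Domain

variable {ℓ Mh k R : ℕ} {P : Fin (d + 1) → ℕ} {D : B6MultiLevelTorusOperator.TDomains d ℓ Mh k P R}

/-- **THE DIRICHLET DOMAIN `Ω₀(□)`** of the cube letters: the image of the open mirror box of □ in the member's torus.
[cite: Balaban1985BackgroundPropagators, p.394 («restricted to Ω₀ with Dirichlet boundary conditions»), p.408 («Ω₀(□)»)] -/
def dirDomC (D : B6MultiLevelTorusOperator.TDomains d ℓ Mh k P R) (q : ↥(cubes D.toDomains)) (hMh : 1 ≤ Mh) (hP : ∀ μ, 1 ≤ P μ) :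
    Finset ↥(boxDom (N0 ℓ Mh k P)) :=
  (boxC D q).image fun y => ⟨B6MultiLevelTorusMirrorL0.emb (ℓ := ℓ) (Mh := Mh) (k := k) (P := P) (gC q) y.1, emb_mem hMh hP (gC q) y.1⟩

/-- membership in `Ω₀(□)`, unfolded. [cite: Balaban1985BackgroundPropagators, p.408, dictionary] -/
theorem mem_dirDomC_iff (hMh : 1 ≤ Mh) (hP : ∀ μ, 1 ≤ P μ) {q : ↥(cubes D.toDomains)} {z : ↥(boxDom (N0 ℓ Mh k P))} :
    z ∈ dirDomC D q hMh hP ↔ ∃ y ∈ boxC D q, B6MultiLevelTorusMirrorL0.emb (ℓ := ℓ) (Mh := Mh) (k := k) (P := P) (gC q) y.1 = z.1 := by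
  unfold dirDomC
  rw [Finset.mem_image]
  constructor
  · rintro ⟨y, hy, he⟩; exact ⟨y, hy, congrArg Subtype.val he⟩
  · rintro ⟨y, hy, he⟩; exact ⟨y, hy, Subtype.ext he⟩

/-- ★ **`C₁(□) ⊂ Ω₀(□)`**: every site of the concentric cube `C₁(□)` is the image of an open-box site (coordinatewise: the centred representative minus the shift in a
mirrored direction, the coordinate itself in a wrapping one). [cite: Balaban1985BackgroundPropagators, p.408 («Ω₀(□) ⊃ Ω₁(□)», «Ω₀(□) ⊂ □⁵»)] -/
theorem mem_dirDomC_of_InC (hL : Odd (ℓ + 1)) (hM : Odd Mh) (hMh : 1 ≤ Mh) (hP : ∀ μ, 1 ≤ P μ) (q : ↥(cubes D.toDomains))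
    {z : ↥(boxDom (N0 ℓ Mh k P))} (hz : InC q 1 z.1) : z ∈ dirDomC D q hMh hP := by
  rw [mem_dirDomC_iff]
  have hs := one_le_sTop (ℓ := ℓ) (k' := kTop q) hMh
  have hh := two_mul_hMir_add_one (ℓ := ℓ) (k' := kTop q) hL hM
  -- the preimage, coordinatewise
  set y : Fin (d + 1) → ℤ := fun μ => if mirC q μ = true then
      z.1 μ + (N0 ℓ Mh k P μ : ℤ) * centre (N0 ℓ Mh k P μ) (z.1 μ - ctrC q μ) - gC q μ else z.1 μ with hy
  have hymem : y ∈ boxDom (N0 ℓ Mh (kTop q) (Pref ℓ k (kTop q) P (mirC q) (mC q))) := by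
    rw [mem_boxDom]; intro μ
    by_cases hμ : mirC q μ = true
    · obtain ⟨h1, h2, -⟩ := exists_preimage_coord (ℓ := ℓ) (R := R) hMh hP hμ (hz μ)
      have hN := N0_Pref_of_mir (ℓ := ℓ) (Mh := Mh) (k := k) (k' := kTop q) (P := P) (m := mC q) hμ
      have hyμ : y μ = z.1 μ + (N0 ℓ Mh k P μ : ℤ) * centre (N0 ℓ Mh k P μ) (z.1 μ - ctrC q μ) - gC q μ := by rw [hy]; simp only [hμ, if_true]
      rw [hyμ]; constructor <;> linarith
    · have hb := (mem_boxDom.1 z.2) μ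
      have hyμ : y μ = z.1 μ := by rw [hy]; simp only [if_neg hμ]
      rw [hyμ, N0_Pref_of_not_mir (kTop_le q) hμ]; exact hb
  refine ⟨⟨y, hymem⟩, ?_, ?_⟩
  · simp only [boxC, mirBoxOpen, Finset.mem_filter, Finset.mem_univ, true_and]
    intro μ hμ
    obtain ⟨h1, h2, -⟩ := exists_preimage_coord (ℓ := ℓ) (R := R) hMh hP hμ (hz μ)
    have hyμ : y μ = z.1 μ + (N0 ℓ Mh k P μ : ℤ) * centre (N0 ℓ Mh k P μ) (z.1 μ - ctrC q μ) - gC q μ := by rw [hy]; simp only [hμ, if_true]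
    simp only [hyμ]
    constructor <;> linarith
  · funext μ
    show (y μ + gC q μ) % (N0 ℓ Mh k P μ : ℤ) = z.1 μ
    have hb := (mem_boxDom.1 z.2) μ
    by_cases hμ : mirC q μ = true
    · obtain ⟨-, -, h3⟩ := exists_preimage_coord (ℓ := ℓ) (R := R) hMh hP hμ (hz μ)
      have hyμ : y μ = z.1 μ + (N0 ℓ Mh k P μ : ℤ) * centre (N0 ℓ Mh k P μ) (z.1 μ - ctrC q μ) - gC q μ := by rw [hy]; simp only [hμ, if_true]
      rw [hyμ, h3]; exact Int.emod_eq_of_lt hb.1 hb.2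
    · have hyμ : y μ = z.1 μ := by rw [hy]; simp only [if_neg hμ]
      have hg : gC q μ = 0 := by unfold gC; rw [if_neg hμ]
      rw [hyμ, hg, add_zero]; exact Int.emod_eq_of_lt hb.1 hb.2

/-- every site of POSITIVE cube level lies in `Ω₀(□)` (`Ω₁(□) ⊂ C₁(□) ⊂ Ω₀(□)`). [cite: Balaban1985BackgroundPropagators, p.408 («Ω₀(□) ⊃ Ω₁(□) ⊃ …»)] -/
theorem mem_dirDomC_of_lev_pos (hL : Odd (ℓ + 1)) (hM : Odd Mh) (hMh : 1 ≤ Mh) (hP : ∀ μ, 1 ≤ P μ) (q : ↥(cubes D.toDomains))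
    {z : ↥(boxDom (N0 ℓ Mh k P))} (hz : 1 ≤ (cubeFam D q hL hM hMh hP).lev z.1) : z ∈ dirDomC D q hMh hP := by
  refine mem_dirDomC_of_InC hL hM hMh hP q ?_
  by_contra hnot
  have := lev_cubeFam_eq_zero (D := D) (q := q) (hL := hL) (hM := hM) (hMh := hMh) (hP := hP) hnot
  omega

/-- the embedding of the open box ONTO `Ω₀(□)`. [cite: Balaban1985BackgroundPropagators, p.408, dictionary] -/
def embC (D : B6MultiLevelTorusOperator.TDomains d ℓ Mh k P R) (q : ↥(cubes D.toDomains)) (hMh : 1 ≤ Mh) (hP : ∀ μ, 1 ≤ P μ)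
    (y : ↥(boxC D q)) : ↥(dirDomC D q hMh hP) :=
  ⟨⟨B6MultiLevelTorusMirrorL0.emb (ℓ := ℓ) (Mh := Mh) (k := k) (P := P) (gC q) y.1.1, emb_mem hMh hP (gC q) y.1.1⟩, Finset.mem_image_of_mem _ y.2⟩

/-- the value of `embC`. [cite: Balaban1985BackgroundPropagators, p.408, dictionary] -/
@[simp] theorem embC_val (hMh : 1 ≤ Mh) (hP : ∀ μ, 1 ≤ P μ) {q : ↥(cubes D.toDomains)} (y : ↥(boxC D q)) :
    (embC D q hMh hP y).1 = ⟨B6MultiLevelTorusMirrorL0.emb (ℓ := ℓ) (Mh := Mh) (k := k) (P := P) (gC q) y.1.1, emb_mem hMh hP (gC q) y.1.1⟩ := rfl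

/-- ★ `embC` is a BIJECTION (injective by D3b `emb_injOn_closed` under FIT, surjective by definition of `Ω₀(□)`). [cite: Balaban1984PropagatorsII, (2.1) p.224 (the torus), bookkeeping] -/
theorem embC_bijective (hMh : 1 ≤ Mh) (hP : ∀ μ, 1 ≤ P μ) (q : ↥(cubes D.toDomains)) : Function.Bijective (embC D q hMh hP) := by
  constructor
  · intro y y' he
    have he' := congrArg (fun z => z.1.1) he
    simp only [embC_val] at he'
    exact Subtype.ext (emb_injOn_closed hMh hP (kTop_le q) (fitC hMh q) (mirBoxOpen_subset_closed y.2) (mirBoxOpen_subset_closed y'.2) he')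
  · intro z
    obtain ⟨y, hy, he⟩ := (mem_dirDomC_iff hMh hP).1 z.2
    exact ⟨⟨y, hy⟩, Subtype.ext (Subtype.ext he)⟩

/-- the open box of □ and `Ω₀(□)` are in bijection. [cite: Balaban1985BackgroundPropagators, p.408, dictionary] -/
def embEquivC (D : B6MultiLevelTorusOperator.TDomains d ℓ Mh k P R) (q : ↥(cubes D.toDomains)) (hMh : 1 ≤ Mh) (hP : ∀ μ, 1 ≤ P μ) :
    ↥(boxC D q) ≃ ↥(dirDomC D q hMh hP) :=
  Equiv.ofBijective _ (embC_bijective hMh hP q)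

/-- the value of the equivalence. [cite: Balaban1985BackgroundPropagators, p.408, dictionary] -/
@[simp] theorem embEquivC_apply (hMh : 1 ≤ Mh) (hP : ∀ μ, 1 ≤ P μ) {q : ↥(cubes D.toDomains)} (y : ↥(boxC D q)) :
    embEquivC D q hMh hP y = embC D q hMh hP y := rfl

end Domain

end

end Literature.MathematicalPhysics.QuantumFieldTheory.Balaban1983to89.B9CubeSequence408Mirrors
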